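import Mathlib
import Summits.ResolutionOfSingularities.ResolutionOfSingularities.Theorems.HomologicalConductorPersistenceCyclicQuotientIsotypicPieces
import HarnessLib

/-!
# Rung S-2 `PersistenceSurface` (stmt-19970), stub C1 (`Sat₄`) — the STAIRCASE SYZYGY IDENTITIES in `k[u,v]`:
# the relations among staircase monomials `g_s = u^{c_s} v^{j_s}` are EXACTLY the consecutive ones, with explicit
# quotients (polynomial level; chain W4.4b, seat res-L1-w44b-stub-4 gen 6; T-V package part 20 = SYZYGY-PLAN S2/S3)

[OURS · L1 w44b · rung S-2] Nothing here is a statement of the manuscript under review (Hironaka 2017);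
AI-written, weaker than expert review.

After parts 15–19 the `Sat₄` certificate at the cyclic quotient surface `U = k[u,v]^{μ_n(1,q)}` needs, per weight
class `a`, an explicit FIRST SYZYGY of the piece `M_a` as a product of pieces (res-L1-w44b-idea-1 SC-TORIC §2(e)(2):
`Ω M_χ ≅ ⊕_t M_{χ − cl γ_t}`).  `M_a` is generated over `U` by a STAIRCASE of monomials `g_s = u^{c_s} v^{j_s}`
(`c` non-increasing, `j` non-decreasing, `s = 0, …, μ`).  This file proves the polynomial identities behind the syzygy
theorem, with NO module theory (that packaging is part 21):

* `monomial_one_dvd_iff_forall_le` — `u^A v^B ∣ p` iff every exponent in the support of `p` dominates `(A, B)`;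
  `monomial_one_dvd_of_dvd_of_dvd` — `u^A ∣ p`, `v^B ∣ p ⇒ u^A v^B ∣ p`.
* **`sum_range_mul_stair_eq`** (TELESCOPE) — if `w_s = v^{j_{s+1}−j_s} r_s − u^{c_{s−1}−c_s} r_{s−1}` (`r_{−1} = 0`) then
  `∑_{s ≤ t} w_s g_s = u^{c_t} v^{j_{t+1}} r_t`; hence (`sum_mul_stair_eq_zero_of_eq`) such `w` with `r_t = 0` for
  `t ≥ μ` is a RELATION `∑_{s ≤ μ} w_s g_s = 0`, and (`eq_zero_of_stair_coords_eq_zero`) `w = 0 ⇒ r = 0`.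
* **`exists_stair_preimage`** (EVERY RELATION IS CONSECUTIVE) — if `∑_{s ≤ μ} w_s g_s = 0` then there are `r_t`
  (`r_t = 0` for `t ≥ μ`) with `w_s = v^{Δj_s} r_s − u^{Δc_{s−1}} r_{s−1}` for all `s ≤ μ`, namely
  `r_t = (∑_{s ≤ t} w_s g_s) / (u^{c_t} v^{j_{t+1}})` (the partial sum is divisible by `u^{c_t}` termwise and by
  `v^{j_{t+1}}` because it equals `−∑_{s > t} w_s g_s`); and if the `w_s` are `σ₀`-INVARIANT and all `g_s` have
  weight class `a`, then `σ₀ r_t = ζ^{ψ_t} r_t` with `ψ_t = −q (j_{t+1} − j_t)`: **`r_t` lies in the piece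
  `M_{−qΔj_t}`** (= `M_{n−d}` for the drop `d = c_t − c_{t+1} ≡ qΔj_t`).
So the kernel of `U^{μ+1} → M_a`, `e_s ↦ g_s`, is parametrised bijectively by `Π_{t<μ} M_{ψ_t}` — the syzygy
formula; part 21 packages it as `IsSyzygy 1 (M a) (Π_t M (ψ t))` for parts 17–19.

References: folklore (syzygies of monomial staircases / Hilbert–Burch for two variables); res-L1-w44b-idea-1
SC-TORIC v2 §2(e) (OURS, memo) for the statement being typed.
-/

-- single-problem summit: the doubled namespace component `ResolutionOfSingularities` is forced
set_option linter.dupNamespace false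

noncomputable section

open MvPolynomial
open Summit.ResolutionOfSingularities.ResolutionOfSingularities.Theorems.HomologicalConductor.PersistenceCyclicQuotientSurface
open Summit.ResolutionOfSingularities.ResolutionOfSingularities.Theorems.HomologicalConductor.PersistenceCyclicQuotientSurfaceFinite
open Summit.ResolutionOfSingularities.ResolutionOfSingularities.Theorems.HomologicalConductor.PersistenceCyclicQuotientIsotypicPieces

universe u

namespace Summit.ResolutionOfSingularities.ResolutionOfSingularities.Theorems.HomologicalConductor.PersistenceStaircaseSyzygy

variable {k : Type u} [Field k]

/-! ## Divisibility by monomials in `k[u,v]` -/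

/-- `u^A v^B ∣ p` iff every exponent vector in the support of `p` dominates the exponent. [folklore] -/
theorem monomial_one_dvd_iff_forall_le (i : Fin 2 →₀ ℕ) (p : MvPolynomial (Fin 2) k) :
    monomial i (1 : k) ∣ p ↔ ∀ s ∈ p.support, i ≤ s := by
  classical
  constructor
  · rintro ⟨y, rfl⟩ s hs
    rw [mem_support_iff, coeff_monomial_mul'] at hs
    by_contra h
    exact hs (by rw [if_neg h])
  · intro h
    rw [monomial_one_dvd_iff_modMonomial_eq_zero]
    ext s
    rw [coeff_zero]
    by_cases hs : i ≤ s
    · exact coeff_modMonomial_of_le p hs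
    · rw [coeff_modMonomial_of_not_le p hs]
      by_contra hne
      exact hs (h s (mem_support_iff.mpr hne))

/-- `u^A ∣ p` and `v^B ∣ p` imply `u^A v^B ∣ p`. [folklore] -/
theorem monomial_one_dvd_of_dvd_of_dvd (A B : ℕ) (p : MvPolynomial (Fin 2) k)
    (hA : monomial (Finsupp.single 0 A) (1 : k) ∣ p) (hB : monomial (Finsupp.single 1 B) (1 : k) ∣ p) :
    monomial (Finsupp.single 0 A + Finsupp.single 1 B) (1 : k) ∣ p := by
  rw [monomial_one_dvd_iff_forall_le] at hA hB ⊢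
  intro s hs
  have h0 := hA s hs
  have h1 := hB s hs
  rw [Finsupp.le_def] at h0 h1 ⊢
  intro i
  fin_cases i
  · simpa using h0 0
  · simpa using h1 1

/-- `monomial d 1 ≠ 0` in `k[u,v]`. [folklore] -/
theorem monomial_one_ne_zero (d : Fin 2 →₀ ℕ) : (monomial d (1 : k) : MvPolynomial (Fin 2) k) ≠ 0 := by
  rw [Ne, monomial_eq_zero]; exact one_ne_zero

/-! ## Staircase monomial identities -/

section Stair

variable (c j : ℕ → ℕ) (hc : Antitone c) (hj : Monotone j)

include hc hj in
/-- `g_t · v^{j_{t+1} − j_t} = u^{c_t} v^{j_{t+1}}`. [folklore] -/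
theorem stair_mul_right (t : ℕ) :
    (monomial (Finsupp.single 0 (c t) + Finsupp.single 1 (j t)) (1 : k) : MvPolynomial (Fin 2) k) *
        monomial (Finsupp.single 1 (j (t + 1) - j t)) 1 =
      monomial (Finsupp.single 0 (c t) + Finsupp.single 1 (j (t + 1))) 1 := by
  have _ := hc
  have hjt : j t ≤ j (t + 1) := hj (Nat.le_succ t)
  have he : Finsupp.single 0 (c t) + Finsupp.single 1 (j t) + Finsupp.single 1 (j (t + 1) - j t) =
      (Finsupp.single 0 (c t) + Finsupp.single 1 (j (t + 1)) : Fin 2 →₀ ℕ) := by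
    ext i
    fin_cases i
    · simp
    · simp
      omega
  rw [monomial_mul, mul_one, he]

include hc hj in
/-- `g_{t+1} · u^{c_t − c_{t+1}} = u^{c_t} v^{j_{t+1}}`. [folklore] -/
theorem stair_succ_mul_left (t : ℕ) :
    (monomial (Finsupp.single 0 (c (t + 1)) + Finsupp.single 1 (j (t + 1))) (1 : k) : MvPolynomial (Fin 2) k) *
        monomial (Finsupp.single 0 (c t - c (t + 1))) 1 =
      monomial (Finsupp.single 0 (c t) + Finsupp.single 1 (j (t + 1))) 1 := by
  have _ := hj
  have hct : c (t + 1) ≤ c t := hc (Nat.le_succ t)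
  have he : Finsupp.single 0 (c (t + 1)) + Finsupp.single 1 (j (t + 1)) + Finsupp.single 0 (c t - c (t + 1)) =
      (Finsupp.single 0 (c t) + Finsupp.single 1 (j (t + 1)) : Fin 2 →₀ ℕ) := by
    ext i
    fin_cases i
    · simp
      omega
    · simp
  rw [monomial_mul, mul_one, he]

include hc hj in
/-- **TELESCOPE.**  If `w_s = v^{Δj_s} r_s − u^{Δc_{s−1}} r_{s−1}` (`r_{−1} := 0`) for all `s ≤ t`, then
`∑_{s ≤ t} w_s g_s = u^{c_t} v^{j_{t+1}} · r_t`. [folklore] -/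
theorem sum_range_mul_stair_eq (w r : ℕ → MvPolynomial (Fin 2) k) (t : ℕ)
    (hw : ∀ s, s ≤ t → w s = monomial (Finsupp.single 1 (j (s + 1) - j s)) 1 * r s -
      if s = 0 then 0 else monomial (Finsupp.single 0 (c (s - 1) - c s)) 1 * r (s - 1)) :
    ∑ s ∈ Finset.range (t + 1), w s * monomial (Finsupp.single 0 (c s) + Finsupp.single 1 (j s)) (1 : k) =
      monomial (Finsupp.single 0 (c t) + Finsupp.single 1 (j (t + 1))) 1 * r t := by
  induction t with
  | zero =>
    rw [Finset.sum_range_one, hw 0 le_rfl, if_pos rfl, sub_zero, mul_right_comm, mul_comm (monomial _ _) (monomial _ _),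
      stair_mul_right c j hc hj 0]
  | succ t ih =>
    rw [Finset.sum_range_succ, ih (fun s hs => hw s (hs.trans (Nat.le_succ t))), hw (t + 1) le_rfl,
      if_neg (Nat.succ_ne_zero t), Nat.add_sub_cancel, sub_mul, mul_right_comm, mul_comm (monomial _ (1 : k)) (monomial _ _),
      stair_mul_right c j hc hj (t + 1), mul_right_comm,
      mul_comm (monomial (Finsupp.single 0 (c t - c (t + 1))) (1 : k)) (monomial _ _), stair_succ_mul_left c j hc hj t]
    ring

include hc hj in
/-- A `w` of the consecutive shape with `r_t = 0` for `t ≥ μ` is a RELATION among `g_0, …, g_μ`. [folklore] -/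
theorem sum_mul_stair_eq_zero_of_eq (w r : ℕ → MvPolynomial (Fin 2) k) (μ : ℕ) (hr : ∀ t, μ ≤ t → r t = 0)
    (hw : ∀ s, s ≤ μ → w s = monomial (Finsupp.single 1 (j (s + 1) - j s)) 1 * r s -
      if s = 0 then 0 else monomial (Finsupp.single 0 (c (s - 1) - c s)) 1 * r (s - 1)) :
    ∑ s ∈ Finset.range (μ + 1), w s * monomial (Finsupp.single 0 (c s) + Finsupp.single 1 (j s)) (1 : k) = 0 := by
  rw [sum_range_mul_stair_eq c j hc hj w r μ hw, hr μ le_rfl, mul_zero]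

include hc hj in
/-- INJECTIVITY: if the consecutive combination with coefficients `r` vanishes coordinatewise, then `r = 0` below `μ`.
[folklore] -/
theorem eq_zero_of_stair_coords_eq_zero (r : ℕ → MvPolynomial (Fin 2) k) (μ : ℕ)
    (hw : ∀ s, s ≤ μ → (monomial (Finsupp.single 1 (j (s + 1) - j s)) 1 * r s -
      if s = 0 then 0 else monomial (Finsupp.single 0 (c (s - 1) - c s)) 1 * r (s - 1) : MvPolynomial (Fin 2) k) = 0)
    (t : ℕ) (ht : t ≤ μ) : r t = 0 := by
  have h := sum_range_mul_stair_eq c j hc hj (fun _ => 0) r t (fun s hs => (hw s (hs.trans ht)).symm)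
  simp only [zero_mul, Finset.sum_const_zero] at h
  exact (mul_eq_zero.mp h.symm).resolve_left (monomial_one_ne_zero _)

include hc hj in
/-- **EVERY RELATION IS CONSECUTIVE (with explicit quotients).**  If `∑_{s ≤ μ} w_s g_s = 0` then with
`r_t := (∑_{s ≤ t} w_s g_s) / (u^{c_t} v^{j_{t+1}})` for `t < μ` (and `r_t := 0` for `t ≥ μ`):
`w_s = v^{Δj_s} r_s − u^{Δc_{s−1}} r_{s−1}` for every `s ≤ μ`. [folklore] -/
theorem exists_stair_preimage (w : ℕ → MvPolynomial (Fin 2) k) (μ : ℕ)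
    (hrel : ∑ s ∈ Finset.range (μ + 1), w s * monomial (Finsupp.single 0 (c s) + Finsupp.single 1 (j s)) (1 : k) = 0) :
    ∃ r : ℕ → MvPolynomial (Fin 2) k, (∀ t, μ ≤ t → r t = 0) ∧
      (∀ t, t < μ → ∑ s ∈ Finset.range (t + 1), w s * monomial (Finsupp.single 0 (c s) + Finsupp.single 1 (j s)) (1 : k) =
        monomial (Finsupp.single 0 (c t) + Finsupp.single 1 (j (t + 1))) 1 * r t) ∧
      (∀ s, s ≤ μ → w s = monomial (Finsupp.single 1 (j (s + 1) - j s)) 1 * r s -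
        if s = 0 then 0 else monomial (Finsupp.single 0 (c (s - 1) - c s)) 1 * r (s - 1)) := by
  classical
  -- partial sums and their factorisation
  set S : ℕ → MvPolynomial (Fin 2) k := fun t =>
    ∑ s ∈ Finset.range (t + 1), w s * monomial (Finsupp.single 0 (c s) + Finsupp.single 1 (j s)) (1 : k) with hS
  have hSt : ∀ t, S t = ∑ s ∈ Finset.range (t + 1),
      w s * monomial (Finsupp.single 0 (c s) + Finsupp.single 1 (j s)) (1 : k) := fun t => rfl
  have hdivu : ∀ t, monomial (Finsupp.single 0 (c t)) (1 : k) ∣ S t := by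
    intro t
    refine Finset.dvd_sum fun s hs => Dvd.dvd.mul_left ?_ _
    rw [Finset.mem_range] at hs
    rw [monomial_dvd_monomial]
    refine ⟨Or.inr ?_, one_dvd _⟩
    rw [Finsupp.le_def]; intro i; fin_cases i
    · have := hc (Nat.le_of_lt_succ hs); simpa using this
    · simp
  have hdivv : ∀ t, t < μ → monomial (Finsupp.single 1 (j (t + 1))) (1 : k) ∣ S t := by
    intro t ht
    have hsplit := Finset.sum_range_add_sum_Ico
      (fun s => w s * monomial (Finsupp.single 0 (c s) + Finsupp.single 1 (j s)) (1 : k)) (show t + 1 ≤ μ + 1 by omega)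
    rw [hrel] at hsplit
    have hSt : S t = -∑ s ∈ Finset.Ico (t + 1) (μ + 1),
        w s * monomial (Finsupp.single 0 (c s) + Finsupp.single 1 (j s)) (1 : k) := eq_neg_of_add_eq_zero_left hsplit
    rw [hSt, dvd_neg]
    refine Finset.dvd_sum fun s hs => Dvd.dvd.mul_left ?_ _
    rw [Finset.mem_Ico] at hs
    rw [monomial_dvd_monomial]
    refine ⟨Or.inr ?_, one_dvd _⟩
    rw [Finsupp.le_def]; intro i; fin_cases i
    · simp
    · have := hj (show t + 1 ≤ s from hs.1); simpa using this
  have hfac : ∀ t, t < μ → S t = monomial (Finsupp.single 0 (c t) + Finsupp.single 1 (j (t + 1))) 1 *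
      divMonomial (S t) (Finsupp.single 0 (c t) + Finsupp.single 1 (j (t + 1))) := by
    intro t ht
    have hd := monomial_one_dvd_of_dvd_of_dvd (c t) (j (t + 1)) (S t) (hdivu t) (hdivv t ht)
    rw [monomial_one_dvd_iff_modMonomial_eq_zero] at hd
    have := divMonomial_add_modMonomial (S t) (Finsupp.single 0 (c t) + Finsupp.single 1 (j (t + 1)))
    rw [hd, add_zero] at this
    exact this.symm
  -- the quotients
  let r : ℕ → MvPolynomial (Fin 2) k := fun t =>
    if t < μ then divMonomial (S t) (Finsupp.single 0 (c t) + Finsupp.single 1 (j (t + 1))) else 0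
  have hrμ : ∀ t, μ ≤ t → r t = 0 := fun t ht => if_neg (not_lt.mpr ht)
  have hSr : ∀ t, t < μ → S t = monomial (Finsupp.single 0 (c t) + Finsupp.single 1 (j (t + 1))) 1 * r t := by
    intro t ht
    change S t = _ * (if t < μ then _ else 0)
    rw [if_pos ht]
    exact hfac t ht
  -- also `S μ = 0 = g̃_μ r_μ`
  have hSr' : ∀ t, t ≤ μ → S t = monomial (Finsupp.single 0 (c t) + Finsupp.single 1 (j (t + 1))) 1 * r t := by
    intro t ht
    rcases lt_or_eq_of_le ht with h | rfl
    · exact hSr t h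
    · rw [hrμ t le_rfl, mul_zero]; exact hrel
  refine ⟨r, hrμ, hSr, fun s hs => ?_⟩
  -- `w_s g_s = S_s − S_{s−1}`; cancel `g_s`
  have hne := monomial_one_ne_zero (k := k) (Finsupp.single 0 (c s) + Finsupp.single 1 (j s))
  apply mul_left_cancel₀ hne
  rcases Nat.eq_zero_or_pos s with rfl | hpos
  · rw [if_pos rfl, sub_zero, ← mul_assoc, stair_mul_right c j hc hj 0, ← hSr' 0 hs, hSt 0, Finset.sum_range_one,
      mul_comm]
  · obtain ⟨t, rfl⟩ : ∃ t, s = t + 1 := ⟨s - 1, by omega⟩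
    rw [if_neg (Nat.succ_ne_zero t), Nat.add_sub_cancel, mul_sub, ← mul_assoc, stair_mul_right c j hc hj (t + 1),
      ← mul_assoc, stair_succ_mul_left c j hc hj t, ← hSr' (t + 1) hs, ← hSr' t (by omega), hSt (t + 1),
      Finset.sum_range_succ, ← hSt t]
    ring

end Stair

/-! ## The quotients are semi-invariants of the right class -/

section Classes

variable {n : ℕ} [NeZero n] {ζ : k} (hζ : IsPrimitiveRoot ζ n) (q : ℕ)

include hζ in
/-- A product `w · p` with `σ₀ w = w` and `σ₀ p = ζ^a p` satisfies `σ₀ (w p) = ζ^a (w p)`; a sum of such terms too;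
a quotient by a monomial shifts the class: if `σ₀ x = ζ^a x` and `x = u^A v^B · y` then `σ₀ y = ζ^{a − (A + qB)} y`.
Packaged for the staircase quotients: **if `∑_{s ≤ t} w_s g_s = u^{c_t} v^{j_{t+1}} r_t` with invariant `w_s` and all
`g_s` of class `a`, then `σ₀ r_t = ζ^{ψ} r_t` with `ψ = a − (c_t + q j_{t+1})`.** [folklore] -/
theorem rootAut_stair_quotient (c j : ℕ → ℕ) (a : ZMod n) (w r : ℕ → MvPolynomial (Fin 2) k) (t : ℕ)
    (hw : ∀ s, s ≤ t → aeval (fun i : Fin 2 => C (ζ ^ (![1, q] : Fin 2 → ℕ) i) * X i) (w s) = w s)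
    (hcl : ∀ s, s ≤ t → ((c s + q * j s : ℕ) : ZMod n) = a)
    (hS : ∑ s ∈ Finset.range (t + 1), w s * monomial (Finsupp.single 0 (c s) + Finsupp.single 1 (j s)) (1 : k) =
      monomial (Finsupp.single 0 (c t) + Finsupp.single 1 (j (t + 1))) 1 * r t) :
    aeval (fun i : Fin 2 => C (ζ ^ (![1, q] : Fin 2 → ℕ) i) * X i) (r t) =
      C (ζ ^ (a - ((c t + q * j (t + 1) : ℕ) : ZMod n)).val) * r t := by
  classical
  set σ₀ := aeval (R := k) (fun i : Fin 2 => C (ζ ^ (![1, q] : Fin 2 → ℕ) i) * X i) with hσ₀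
  -- the partial sum has class `a`
  have hSum : σ₀ (∑ s ∈ Finset.range (t + 1), w s * monomial (Finsupp.single 0 (c s) + Finsupp.single 1 (j s)) (1 : k)) =
      C (ζ ^ a.val) * ∑ s ∈ Finset.range (t + 1), w s * monomial (Finsupp.single 0 (c s) + Finsupp.single 1 (j s)) (1 : k) := by
    rw [map_sum, Finset.mul_sum]
    refine Finset.sum_congr rfl fun s hs => ?_
    rw [Finset.mem_range] at hs
    rw [map_mul, hw s (Nat.le_of_lt_succ hs), hσ₀, rootAut_monomial]
    have hpow : ζ ^ ((Finsupp.single 0 (c s) + Finsupp.single 1 (j s) : Fin 2 →₀ ℕ) 0 +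
        q * (Finsupp.single 0 (c s) + Finsupp.single 1 (j s) : Fin 2 →₀ ℕ) 1) = ζ ^ a.val := by
      rw [pow_eq_pow_iff_modEq_of_isPrimitiveRoot hζ, ← ZMod.natCast_eq_natCast_iff, ZMod.natCast_val, ZMod.cast_id',
        id, ← hcl s (Nat.le_of_lt_succ hs)]
      simp
    rw [hpow]
    ring
  -- support of the partial sum: all weights `= a`
  have hsupp := (rootAut_eq_C_mul_iff hζ q a _).mp hSum
  -- support of `r t`: shifted by the monomial
  rw [rootAut_eq_C_mul_iff hζ]
  intro d hd
  have hd' : Finsupp.single 0 (c t) + Finsupp.single 1 (j (t + 1)) + d ∈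
      (∑ s ∈ Finset.range (t + 1), w s * monomial (Finsupp.single 0 (c s) + Finsupp.single 1 (j s)) (1 : k)).support := by
    rw [hS, mem_support_iff, coeff_monomial_mul', if_pos le_self_add, one_mul, add_tsub_cancel_left]
    exact mem_support_iff.mp hd
  have h := hsupp _ hd'
  simp only [Finsupp.coe_add, Pi.add_apply, Finsupp.single_eq_same, Finsupp.single_eq_of_ne (one_ne_zero),
    Finsupp.single_eq_of_ne (zero_ne_one), add_zero, zero_add] at h
  rw [← h]
  push_cast
  ring

end Classes

end Summit.ResolutionOfSingularities.ResolutionOfSingularities.Theorems.HomologicalConductor.PersistenceStaircaseSyzygy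

end
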